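import Mathlib
import Summits.Schanuel.Schanuel.Theses.RigidCore
import Summits.Schanuel.Schanuel.Theorems.AclSubsetLogFreeCore.Negative.LogFreeCoreObjects

/-!
# Crux `RigidCore.SchanuelOnLogFreeCore` (R), line `sector-split`, stub C23: core Hermite–Lindemann ⟹ no fixed point of `exp` lies in the log-free core `C_EA`

Support file for crux `stmt-Schanuel-0970`
(`Summit.Schanuel.Schanuel.Theses.RigidCore.SchanuelOnLogFreeCore`, "(R)": Schanuel's statement for
`ℚ`-linearly independent tuples from the log-free core
`C_EA = logFreeCore = sInf {K ≤ ℂ | 2πi ∈ K, K exp-closed, K relatively algebraically closed}`),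
registered stub `stub_fixedPoint_of_coreHL` (calibration C23) of the line's skeleton (lead c12).

* `stub_fixedPoint_of_coreHL` (registered signature verbatim): **core Hermite–Lindemann ⟹ no fixed
  point of `exp` lies in `C_EA`**.  Here "core Hermite–Lindemann" is the explicit hypothesis
  `∀ u ∈ C_EA, eᵘ algebraic over ℚ(2πi, u) ⟹ u ∈ ℚ·2πi` — the conclusion of the lead's stub C22
  `stub_coreHL_of_crux : (R) ⟹ core HL`, used as a black box.
  PROOF: a fixed point `eᵘ = u` is trivially algebraic over `ℚ(2πi, u) ∋ u`, so core HL puts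
  `u = q·2πi` with `q ∈ ℚ`; but then `|eᵘ| = |e^{2πiq}| = 1` while `|u| = 2π|q|`, so `2π|q| = 1` and
  `π = 1/(2|q|) ∈ ℚ` — contradicting `irrational_pi`.  The unconditional Step 3 is isolated as
  `FixedPointCoreHL.fixedPoint_not_mem_span_two_pi_I` (**no fixed point of `exp` is a rational
  multiple of `2πi`**).
* Composed in the lead's skeleton with C22 (`(R) ⟹ core HL`) and with the crux (A)
  `RigidCore.AclSubsetLogFreeCore` (`acl^{ℂ_exp}(∅) ⊆ C_EA`) it gives: **(A) ∧ (R) ⟹ no fixed point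
  of `exp` is `∅`-algebraic in `ℂ_exp = (ℂ, +, ·, exp)`** — fixed-point indiscernibility in
  finite-set form (no parameter-free formula isolates a finite non-empty set of solutions of
  `eᶻ = z`), cf. D. Marker, *A remark on Zilber's pseudoexponentiation*, JSL 71 (2006).

What is NOT claimed: (R), (A), or core HL themselves (open); everything here is either
unconditional (`FixedPointCoreHL.*`) or takes core HL as an explicit hypothesis.
Sources: D. Marker, *A remark on Zilber's pseudoexponentiation*, J. Symbolic Logic 71 (2006)
791–798 [Marker2006]; Mathlib `irrational_pi`.
-/

noncomputable section

set_option linter.dupNamespace false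

open Summit.Schanuel.Schanuel.Theses
open Summit.Schanuel.Schanuel.Theorems.AclSubsetLogFreeCore.Negative

namespace Summit.Schanuel.Schanuel.Theorems.RigidCore

namespace FixedPointCoreHL

/-- The modulus of a rational multiple `q·2πi` of `2πi` is `|q|·2π`. [folklore] -/
theorem norm_ratCast_mul_two_pi_I (q : ℚ) :
    ‖(q : ℂ) * (2 * ↑Real.pi * Complex.I)‖ = |(q : ℝ)| * (2 * Real.pi) := by
  simp [abs_of_pos Real.pi_pos]

/-- `e^{q·2πi}` has modulus `1` for every rational `q`. [folklore] -/
theorem norm_exp_ratCast_mul_two_pi_I (q : ℚ) :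
    ‖Complex.exp ((q : ℂ) * (2 * ↑Real.pi * Complex.I))‖ = 1 := by
  have h : (q : ℂ) * (2 * ↑Real.pi * Complex.I) =
      (((q : ℝ) * (2 * Real.pi) : ℝ) : ℂ) * Complex.I := by
    push_cast; ring
  rw [h, Complex.norm_exp_ofReal_mul_I]

/-- `π` is irrational, so `|q|·2π ≠ 1` for every rational `q`. [folklore] -/
theorem abs_ratCast_mul_two_pi_ne_one (q : ℚ) : |(q : ℝ)| * (2 * Real.pi) ≠ 1 := by
  intro h
  have hq : (2 * |q| : ℚ) ≠ 0 := by
    intro h0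
    have h1 : ((2 * |q| : ℚ) : ℝ) = 0 := by rw [h0]; simp
    push_cast at h1
    have h2 : |(q : ℝ)| = 0 := by linarith
    rw [h2, zero_mul] at h
    exact zero_ne_one h
  have hirr : Irrational (((2 * |q| : ℚ) : ℝ) * Real.pi) := irrational_pi.ratCast_mul hq
  exact hirr ⟨1, by push_cast; linarith⟩

/-- **No fixed point of `exp` is a rational multiple of `2πi`** (unconditional): if `eᵘ = u` and
`u = q·2πi` then `1 = |e^{2πiq}| = |u| = 2π|q|`, i.e. `π = 1/(2|q|) ∈ ℚ`, contradicting the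
irrationality of `π`. [folklore] -/
theorem fixedPoint_not_mem_span_two_pi_I {u : ℂ} (hfix : Complex.exp u = u) :
    u ∉ Submodule.span ℚ ({(2 * ↑Real.pi * Complex.I : ℂ)} : Set ℂ) := by
  intro hmem
  obtain ⟨q, hq⟩ := Submodule.mem_span_singleton.1 hmem
  rw [Rat.smul_def] at hq
  have h1 : ‖Complex.exp u‖ = 1 := by
    rw [← hq]
    exact norm_exp_ratCast_mul_two_pi_I q
  rw [hfix, ← hq, norm_ratCast_mul_two_pi_I] at h1
  exact abs_ratCast_mul_two_pi_ne_one q h1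

/-- In particular `0` is not a fixed point of `exp` inside `ℚ·2πi`-reasoning: a fixed point of
`exp` is non-zero (`e⁰ = 1 ≠ 0`). [folklore] -/
theorem fixedPoint_ne_zero {u : ℂ} (hfix : Complex.exp u = u) : u ≠ 0 := by
  rintro rfl
  simp at hfix

/-- A fixed point `eᵘ = u` is algebraic over `ℚ(2πi, u)` (indeed `eᵘ = u ∈ ℚ(2πi, u)`).
[folklore] -/
theorem isAlgebraic_exp_of_fixedPoint {u : ℂ} (hfix : Complex.exp u = u) :
    IsAlgebraic (↥(IntermediateField.adjoin ℚ ({(2 * ↑Real.pi * Complex.I : ℂ), u} : Set ℂ)))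
      (Complex.exp u) := by
  have hmem : u ∈ IntermediateField.adjoin ℚ ({(2 * ↑Real.pi * Complex.I : ℂ), u} : Set ℂ) :=
    IntermediateField.subset_adjoin ℚ _ (Set.mem_insert_of_mem _ (Set.mem_singleton u))
  rw [hfix]
  exact isAlgebraic_algebraMap
    (⟨u, hmem⟩ : ↥(IntermediateField.adjoin ℚ ({(2 * ↑Real.pi * Complex.I : ℂ), u} : Set ℂ)))

end FixedPointCoreHL

/-- **Registered stub `stub_fixedPoint_of_coreHL` (C23) of line `sector-split` — core
Hermite–Lindemann ⟹ no fixed point of `exp` lies in the log-free core** (signature verbatim): if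
every `u ∈ C_EA = logFreeCore` with `eᵘ` algebraic over `ℚ(2πi, u)` lies on `ℚ·2πi` (core HL, the
conclusion of C22 `stub_coreHL_of_crux`), then no solution of `eᵘ = u` lies in `C_EA`: `eᵘ = u` is
algebraic over `ℚ(2πi, u)` (`FixedPointCoreHL.isAlgebraic_exp_of_fixedPoint`), and a fixed point is
never on `ℚ·2πi` (`FixedPointCoreHL.fixedPoint_not_mem_span_two_pi_I`, via `irrational_pi`).  With
(A) this is fixed-point indiscernibility in finite-set form, cf. Marker 2006. [cite: Marker2006] -/
theorem stub_fixedPoint_of_coreHL :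
    (∀ u : ℂ, u ∈ logFreeCore →
        IsAlgebraic (↥(IntermediateField.adjoin ℚ ({(2 * ↑Real.pi * Complex.I : ℂ), u} : Set ℂ)))
            (Complex.exp u) →
          u ∈ Submodule.span ℚ ({(2 * ↑Real.pi * Complex.I : ℂ)} : Set ℂ)) →
      ∀ u : ℂ, Complex.exp u = u → u ∉ logFreeCore := by
  intro hHL u hfix hu
  exact FixedPointCoreHL.fixedPoint_not_mem_span_two_pi_I hfix
    (hHL u hu (FixedPointCoreHL.isAlgebraic_exp_of_fixedPoint hfix))

namespace FixedPointCoreHL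

/-- Restatement by name: under core HL, the fixed-point locus `{u | eᵘ = u}` is disjoint from the
log-free core. [folklore] -/
theorem fixedPoints_disjoint_core_of_coreHL
    (hHL : ∀ u : ℂ, u ∈ logFreeCore →
        IsAlgebraic (↥(IntermediateField.adjoin ℚ ({(2 * ↑Real.pi * Complex.I : ℂ), u} : Set ℂ)))
            (Complex.exp u) →
          u ∈ Submodule.span ℚ ({(2 * ↑Real.pi * Complex.I : ℂ)} : Set ℂ)) :
    Disjoint {u : ℂ | Complex.exp u = u} (logFreeCore : Set ℂ) :=
  Set.disjoint_left.2 fun u hfix hu => stub_fixedPoint_of_coreHL hHL u hfix hu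

end FixedPointCoreHL

end Summit.Schanuel.Schanuel.Theorems.RigidCore

end
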